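import Mathlib.Order.Filter.AtTopBot.Basic
import Literature.NumberTheory.EllipticCurves.Selmer
import Literature.NumberTheory.EllipticCurves.HeightFamily
import HarnessLib

/-!
# Bhargava–Shankar–Swaminathan: the second moment of `#Sel₂` is at most `15`

Named fact (D-0014) vendoring Theorem 1.1 of M. Bhargava, A. Shankar, A. Swaminathan,
*The second moment of the size of the 2-Selmer group of elliptic curves*, arXiv:2110.09063 (2021):

> **Theorem 1.1.** When elliptic curves over `ℚ` are ordered by height, the second moment of the
> size of the `2`-Selmer group is at most `15`.

The family and height of *loc. cit.* §1.1 (p. 1): every `E/ℚ` is isomorphic to a unique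
`E^{I,J} : y² = x³ − (I/3)x − J/27` with `3 ∣ I`, `27 ∣ J` and no prime `p` with `3p⁴ ∣ I` and
`27p⁶ ∣ J`; `H(E^{I,J}) = (4/27) max{|I|³, J²/4}`. Under `A = −I/3`, `B = −J/27` this is exactly
the tree's family `IsInHeightFamily (A, B)` (no prime with `p⁴ ∣ A ∧ p⁶ ∣ B`) with
`naiveHeight (A, B) = max (4|A|³) (27B²)` (Bhargava–Shankar, Ann. of Math. 181 (2015) §1), so the
statement is phrased with the tree's `heightAverage` / `HeightAverageLE` exactly like the companion
first-moment facts `average_card_selmerTwo` / `heightAverageLE_card_selmerTwo` (bsd.S26, BSDSelmer).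
"At most 15" is the `limsup` reading, which is what the proof delivers (§7.4, p. 43:
`(1/(ν(F) χ̂(0) X^{5/6})) Σ_{H(E)<X} |Sel₂(E)|² ≤ 15 + O(ε) + o_ε(1)`, then `X → ∞`, `ε → 0`).
The paper proves the same bound for every large (acceptable) subfamily defined by congruence
conditions; only the universal family is vendored here.

This fact grounds `Summit.QuantumAdvantage.QuantumAdvantage.Theses.SelmerBand.SecondMomentLE`
(verbatim the same proposition) and, with `average_card_selmerTwo`, the Cauchy–Schwarz half of
`Summit.QuantumAdvantage.QuantumAdvantage.Theses.SelmerBand.PriorBand`.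

What is NOT here: the conjectural equality `= 15` (Poonen–Rains, Conj. 1.3 of loc. cit., proved in
loc. cit. only under a tail estimate), Theorem 1.2 (average `#Sel₂` of Jacobians of locally soluble
genus-one curves `z² = f(x,y)` is at most `6`), and higher moments.
-/

namespace Literature.NumberTheory.EllipticCurves

open Filter WeierstrassCurve

/-- **Bhargava–Shankar–Swaminathan 2021, Theorem 1.1** (arXiv:2110.09063, p. 1): "When elliptic
curves over `ℚ` are ordered by height, the second moment of the size of the `2`-Selmer group is at
most `15`." In the tree's language: for every `ε > 0`, eventually in `X` the average of
`(#Sel^(2)(E_{A,B}/ℚ))²` over the curves `E_{A,B} : y² = x³ + Ax + B` of the height family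
(`IsInHeightFamily`, one per `ℚ`-isomorphism class) with naive height `max(4|A|³, 27B²) < X` is at
most `15 + ε` (`limsup` form, as for `heightAverageLE_card_selmerTwo`). Grounds
`Summit.QuantumAdvantage.QuantumAdvantage.Theses.SelmerBand.SecondMomentLE` (same proposition).
[cite: BhargavaShankarSwaminathan2021, Thm 1.1] -/
def heightAverageLE_sq_card_selmerTwo : Prop :=
  HeightAverageLE (fun AB ↦ ((Nat.card ((shortWeierstrass AB).selmerGroup 2) : ℝ)) ^ 2) 15

end Literature.NumberTheory.EllipticCurves
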